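import Mathlib.RingTheory.MvPolynomial.Symmetric.NewtonIdentities
import Mathlib.RingTheory.MvPolynomial.Homogeneous
import Mathlib.Algebra.MvPolynomial.Coeff
import Mathlib.RingTheory.Adjoin.Basic
import Mathlib.Logic.Equiv.Fin.Basic
import Mathlib.Data.Fintype.Perm
import HarnessLib

/-!
# Weyl's theorem on multisymmetric polynomials (characteristic zero)

Let `k` be a field of characteristic zero, `ι` a finite set of coordinates and `n` a number of
vectors. The symmetric group `S_n` acts on the polynomial ring
`k[V^n] = MvPolynomial (ι × Fin n) k` (`X (i, j)` = the `i`-th coordinate of the `j`-th vector) by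
permuting the vectors; the invariants are the MULTISYMMETRIC polynomials (`IsMultisymmetric`).
The ELEMENTARY multisymmetric polynomials `e_α`, `α : ι →₀ ℕ`, `1 ≤ |α| ≤ n`
(`elemMultisymm ι n α`) are the coefficients of `T^α` in the generating product
`∏_{j < n} (1 + ∑_i X_{(i,j)} T_i)` (`genElem`) — the polarizations of the elementary symmetric
polynomials.

**Theorem** (`IsMultisymmetric.mem_adjoin_elemMultisymm`). In characteristic zero every
multisymmetric polynomial is a polynomial in the elementary multisymmetric polynomials:
`k[V^n]^{S_n} = k[e_α : α]`. H. Weyl, *The Classical Groups* (Princeton, 1939), Chap. II, §3,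
Theorem (2.3.A) (the fundamental theorem for symmetric functions of several vectors; classically
Schläfli and MacMahon; history in M. Domokos, J. Lie Theory 19 (2009) = arXiv:0706.2154, §1,
remark (ii) after Thm. 1.1: "when the field has characteristic zero, this algebra is generated by
the polarizations of the elementary symmetric polynomials"). The statement fails in
characteristic `0 < p ≤ n`.

**Proof formalised here** (the power-sum route, all in characteristic zero):
1. a multisymmetric `G` is `(n!)⁻¹ ∑_τ τ·G`, a combination of the orbit sums of its monomials, and
   the orbit sum of a monomial is an "injective sum" `IS(L) = ∑_{f : Fin r ↪ Fin n} ∏_k U_{f k}^{L_k}`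
   of column monomials `U_j^β = ∏_i X_{(i,j)}^{β_i}` (`orbitSum_monomial_eq_injSum`);
2. the recursion `p_β · IS(L) = IS(β :: L) + ∑_{k} IS(L[k += β])` for the polarized power sums
   `p_β = ∑_j U_j^β` (`powerSum_mul_injSum`) puts every injective sum in `k[p_β : β]`
   (`injSum_mem_adjoin_powerSum`; Domokos, Prop. 2.1, is the same device);
3. the power sums lie in `k[e_α]`: with `z_j = ∑_i X_{(i,j)} T_i`, Newton's identities for
   `z_1,…,z_n` (Mathlib `MvPolynomial.psum_eq_mul_esymm_sub_sum`) show that all `T`-coefficients of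
   `∑_j z_j^d` are polynomials in the `T`-coefficients `e_α` of `esymm_d(z)`, the degree-`d` part of
   `genElem`, and the `T^β`-coefficient of `∑_j z_j^{|β|}` is `multinomial(β) · p_β` (multinomial
   theorem, Mathlib `coeff_linearCombination_X_pow_of_fintype`) with `multinomial(β) ≠ 0`
   (`powerSum_mem_adjoin_elemMultisymm`).

Used downstream (`Literature/Computability/AlgebraicComplexity/ChowCokernel.lean`) for the
normalisation of the Chow variety of products of linear forms (Bürgisser–Hüttenhain–Ikenmeyer
2017, §3).
-/

noncomputable section

open MvPolynomial

namespace Literature.RingTheory.Multisymmetric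

variable {k : Type*} [Field k] (ι : Type*) [Fintype ι] (n : ℕ)

/-! ### Multisymmetric polynomials, column monomials, power sums, elementary multisymmetric
polynomials -/

/-- **Multisymmetric**: invariant under every permutation of the `n` vectors (the second index).
[cite: Weyl1939, Chap. II §3 (symmetric functions of several vectors)] -/
def IsMultisymmetric (G : MvPolynomial (ι × Fin n) k) : Prop :=
  ∀ τ : Equiv.Perm (Fin n), rename (Prod.map id ⇑τ) G = G

/-- The column monomial `U_j^β = ∏_i X_{(i,j)}^{β_i}` (a monomial in the coordinates of the `j`-th
vector). [folklore] -/
def colMonomial (j : Fin n) (β : ι →₀ ℕ) : MvPolynomial (ι × Fin n) k :=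
  monomial (β.mapDomain fun i => (i, j)) 1

/-- The polarized power sum `p_β = ∑_j U_j^β` (Domokos: "`[w] = ∑_j w_{⟨j⟩}` ... polarizations of
the usual power sum symmetric functions"). [cite: Domokos2009, §2 (the invariants [w])] -/
def powerSum (β : ι →₀ ℕ) : MvPolynomial (ι × Fin n) k :=
  ∑ j : Fin n, colMonomial ι n j β

/-- The generic linear form `z_j = ∑_i X_{(i,j)} T_i` of the `j`-th vector against auxiliary
variables `T_i`. [folklore] -/
def zLin (j : Fin n) : MvPolynomial ι (MvPolynomial (ι × Fin n) k) :=
  ∑ i : ι, C (X (i, j)) * X i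

/-- The generating product `E(T) = ∏_j (1 + z_j(T)) = ∑_α e_α T^α` of the elementary multisymmetric
polynomials. [cite: Weyl1939, Chap. II §3 (Theorem 2.3.A)] -/
def genElem : MvPolynomial ι (MvPolynomial (ι × Fin n) k) :=
  ∏ j : Fin n, (1 + zLin ι n j)

/-- **The elementary multisymmetric polynomial `e_α`**: the coefficient of `T^α` in
`∏_j (1 + ∑_i X_{(i,j)} T_i)` (the polarizations of the elementary symmetric polynomials; `e_α = 0`
unless `|α| ≤ n`). [cite: Weyl1939, Chap. II §3 (Theorem 2.3.A)] -/
def elemMultisymm (α : ι →₀ ℕ) : MvPolynomial (ι × Fin n) k :=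
  coeff α (genElem ι n)

/-- The subalgebra `k[e_α : α]` generated by the elementary multisymmetric polynomials.
[cite: Weyl1939, Chap. II §3 (Theorem 2.3.A)] -/
abbrev elemSubalgebra : Subalgebra k (MvPolynomial (ι × Fin n) k) :=
  Algebra.adjoin k (Set.range (elemMultisymm (k := k) ι n))

/-! ### Step 3: the power sums are polynomials in the elementary multisymmetric polynomials -/

/-- The substitution `Y_j ↦ z_j` from symmetric functions in `n` letters. [folklore] -/
def theta : MvPolynomial (Fin n) (MvPolynomial (ι × Fin n) k) →ₐ[MvPolynomial (ι × Fin n) k]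
    MvPolynomial ι (MvPolynomial (ι × Fin n) k) :=
  aeval fun j => zLin ι n j

/-- `z_j` is linear in `T`. [folklore] -/
theorem zLin_isHomogeneous (j : Fin n) : (zLin (k := k) ι n j).IsHomogeneous 1 :=
  IsHomogeneous.sum _ _ _ fun i _ => by
    have h := (isHomogeneous_C ι (X (i, j) : MvPolynomial (ι × Fin n) k)).mul
      (isHomogeneous_X (MvPolynomial (ι × Fin n) k) i)
    rwa [zero_add] at h

/-- **`esymm_d(z_1,…,z_n)` is the degree-`d` part of the generating product.** [folklore] -/
theorem theta_esymm (d : ℕ) :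
    theta ι n (esymm (Fin n) (MvPolynomial (ι × Fin n) k) d) =
      homogeneousComponent d (genElem (k := k) ι n) := by
  classical
  rw [esymm, map_sum, genElem, Finset.prod_one_add, map_sum, Finset.powersetCard_eq_filter,
    Finset.sum_filter]
  refine Finset.sum_congr rfl fun t _ => ?_
  rw [map_prod]
  simp only [theta, aeval_X]
  have ht : (∏ j ∈ t, zLin (k := k) ι n j).IsHomogeneous t.card := by
    have h := IsHomogeneous.prod t (fun j => zLin (k := k) ι n j) (fun _ => 1)
      fun j _ => zLin_isHomogeneous ι n j
    simpa using h
  rw [homogeneousComponent_of_mem ((mem_homogeneousSubmodule _ _).mpr ht)]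
  by_cases h : t.card = d
  · rw [if_pos h, if_pos h.symm]
  · rw [if_neg h, if_neg (Ne.symm h)]

/-- The coefficients of `esymm_d(z)` are elementary multisymmetric polynomials (or zero).
[folklore] -/
theorem coeff_theta_esymm (d : ℕ) (α : ι →₀ ℕ) :
    coeff α (theta ι n (esymm (Fin n) (MvPolynomial (ι × Fin n) k) d)) =
      if α.degree = d then elemMultisymm ι n α else 0 := by
  rw [theta_esymm, coeff_homogeneousComponent, elemMultisymm]

/-- "All `T`-coefficients lie in `k[e_α]`", a predicate stable under the ring operations.
[folklore] -/
def CoeffsIn (P : MvPolynomial ι (MvPolynomial (ι × Fin n) k)) : Prop :=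
  ∀ α : ι →₀ ℕ, coeff α P ∈ elemSubalgebra (k := k) ι n

variable {ι n}

/-- `CoeffsIn` is additive. [folklore] -/
theorem CoeffsIn.add {P Q : MvPolynomial ι (MvPolynomial (ι × Fin n) k)} (hP : CoeffsIn ι n P)
    (hQ : CoeffsIn ι n Q) : CoeffsIn ι n (P + Q) := fun α => by
  rw [coeff_add]
  exact Subalgebra.add_mem _ (hP α) (hQ α)

/-- `CoeffsIn` is stable under subtraction. [folklore] -/
theorem CoeffsIn.sub {P Q : MvPolynomial ι (MvPolynomial (ι × Fin n) k)} (hP : CoeffsIn ι n P)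
    (hQ : CoeffsIn ι n Q) : CoeffsIn ι n (P - Q) := fun α => by
  rw [coeff_sub]
  exact Subalgebra.sub_mem _ (hP α) (hQ α)

/-- `CoeffsIn` is multiplicative. [folklore] -/
theorem CoeffsIn.mul {P Q : MvPolynomial ι (MvPolynomial (ι × Fin n) k)} (hP : CoeffsIn ι n P)
    (hQ : CoeffsIn ι n Q) : CoeffsIn ι n (P * Q) := fun α => by
  classical
  rw [coeff_mul]
  exact Subalgebra.sum_mem _ fun p _ => Subalgebra.mul_mem _ (hP p.1) (hQ p.2)

/-- `CoeffsIn` of finite sums. [folklore] -/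
theorem CoeffsIn.sum {κ : Type*} {s : Finset κ} {P : κ → MvPolynomial ι (MvPolynomial (ι × Fin n) k)}
    (hP : ∀ a ∈ s, CoeffsIn ι n (P a)) : CoeffsIn ι n (∑ a ∈ s, P a) := fun α => by
  rw [coeff_sum]
  exact Subalgebra.sum_mem _ fun a ha => hP a ha α

/-- Constants from the subalgebra have `CoeffsIn`. [folklore] -/
theorem CoeffsIn.const {c : MvPolynomial (ι × Fin n) k} (hc : c ∈ elemSubalgebra (k := k) ι n) :
    CoeffsIn ι n (MvPolynomial.C c : MvPolynomial ι (MvPolynomial (ι × Fin n) k)) := fun α => by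
  classical
  rw [MvPolynomial.coeff_C]
  split_ifs
  · exact hc
  · exact Subalgebra.zero_mem _

/-- Powers of `-1` have `CoeffsIn`. [folklore] -/
theorem CoeffsIn.neg_one_pow (j : ℕ) :
    CoeffsIn (k := k) ι n ((-1 : MvPolynomial ι (MvPolynomial (ι × Fin n) k)) ^ j) := by
  have h : ((-1 : MvPolynomial ι (MvPolynomial (ι × Fin n) k)) ^ j) =
      MvPolynomial.C ((-1 : MvPolynomial (ι × Fin n) k) ^ j) := by
    rw [map_pow, map_neg, map_one]
  rw [h]
  exact CoeffsIn.const (Subalgebra.pow_mem _ (Subalgebra.neg_mem _ (Subalgebra.one_mem _)) j)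

/-- Natural number constants have `CoeffsIn`. [folklore] -/
theorem CoeffsIn.natCast (d : ℕ) :
    CoeffsIn (k := k) ι n (d : MvPolynomial ι (MvPolynomial (ι × Fin n) k)) := by
  rw [← map_natCast (MvPolynomial.C : MvPolynomial (ι × Fin n) k →+* _) d]
  exact CoeffsIn.const (Subalgebra.natCast_mem _ d)

variable (ι n)

/-- The coefficients of `esymm_d(z)` lie in `k[e_α]`. [folklore] -/
theorem coeffsIn_theta_esymm (d : ℕ) :
    CoeffsIn ι n (theta ι n (esymm (Fin n) (MvPolynomial (ι × Fin n) k) d)) := fun α => by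
  rw [coeff_theta_esymm]
  split_ifs
  · exact Algebra.subset_adjoin ⟨α, rfl⟩
  · exact Subalgebra.zero_mem _

/-- **Newton's identities: the coefficients of `∑_j z_j^d` lie in `k[e_α]`** (strong induction on
`d`, Mathlib `MvPolynomial.psum_eq_mul_esymm_sub_sum` pushed through `Y_j ↦ z_j`).
[cite: Weyl1939, Chap. II §3 (Theorem 2.3.A, via power sums)] -/
theorem coeffsIn_theta_psum (d : ℕ) :
    CoeffsIn ι n (theta ι n (psum (Fin n) (MvPolynomial (ι × Fin n) k) d)) := by
  classical
  induction d using Nat.strong_induction_on with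
  | _ d ih =>
    rcases Nat.eq_zero_or_pos d with rfl | hd
    · rw [psum_zero, map_natCast]
      exact CoeffsIn.natCast _
    · rw [psum_eq_mul_esymm_sub_sum (Fin n) (MvPolynomial (ι × Fin n) k) d hd, map_sub, map_sum]
      refine CoeffsIn.sub ?_ (CoeffsIn.sum fun a ha => ?_)
      · rw [map_mul, map_mul, map_pow, map_neg, map_one, map_natCast]
        exact ((CoeffsIn.neg_one_pow _).mul (CoeffsIn.natCast _)).mul (coeffsIn_theta_esymm ι n d)
      · rw [Finset.mem_filter, Finset.mem_antidiagonal] at ha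
        obtain ⟨hsum, hlo, hhi⟩ := ha
        rw [map_mul, map_mul, map_pow, map_neg, map_one]
        exact ((CoeffsIn.neg_one_pow _).mul (coeffsIn_theta_esymm ι n a.1)).mul
          (ih a.2 (by omega))

omit [Fintype ι] in
/-- A column monomial written as a `Finsupp.prod` of powers (the shape produced by the
multinomial theorem). [folklore] -/
theorem prod_X_pow_eq_colMonomial (j : Fin n) (β : ι →₀ ℕ) :
    β.prod (fun i e => (X (i, j) : MvPolynomial (ι × Fin n) k) ^ e) = colMonomial ι n j β := by
  rw [colMonomial, monomial_eq, C_1, one_mul,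
    Finsupp.prod_mapDomain_index (fun _ => pow_zero _) (fun _ _ _ => pow_add _ _ _)]

/-- **The multinomial theorem: the `T^β`-coefficient of `∑_j z_j^{|β|}` is `multinomial(β) · p_β`.**
[folklore] -/
theorem coeff_theta_psum_degree (β : ι →₀ ℕ) :
    coeff β (theta ι n (psum (Fin n) (MvPolynomial (ι × Fin n) k) β.degree)) =
      (β.multinomial : MvPolynomial (ι × Fin n) k) * powerSum ι n β := by
  classical
  rw [psum, map_sum, coeff_sum, powerSum, Finset.mul_sum]
  refine Finset.sum_congr rfl fun j _ => ?_
  rw [map_pow, theta, aeval_X]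
  have hform : zLin (k := k) ι n j = ∑ i : ι, (X (i, j) : MvPolynomial (ι × Fin n) k) • X i := by
    simp only [zLin, smul_eq_C_mul]
  rw [hform, coeff_linearCombination_X_pow_of_fintype,
    if_pos (by simp [Finsupp.degree_apply, Finsupp.sum]), prod_X_pow_eq_colMonomial]

/-- **The polarized power sums are polynomials in the elementary multisymmetric polynomials**
(characteristic zero: division by `multinomial(β) ≠ 0`). [cite: Weyl1939, Chap. II §3 (Theorem 2.3.A)] -/
theorem powerSum_mem_adjoin_elemMultisymm [CharZero k] (β : ι →₀ ℕ) :
    powerSum ι n β ∈ elemSubalgebra (k := k) ι n := by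
  have h := coeffsIn_theta_psum (k := k) ι n β.degree β
  rw [coeff_theta_psum_degree] at h
  have hpos : 0 < β.multinomial := by
    rw [Finsupp.multinomial_eq]
    exact Nat.multinomial_pos _ _
  have hne : (β.multinomial : k) ≠ 0 := Nat.cast_ne_zero.mpr hpos.ne'
  have heq : powerSum (k := k) ι n β =
      (β.multinomial : k)⁻¹ • ((β.multinomial : MvPolynomial (ι × Fin n) k) * powerSum ι n β) := by
    rw [show (β.multinomial : MvPolynomial (ι × Fin n) k) =
        algebraMap k (MvPolynomial (ι × Fin n) k) (β.multinomial : k) by simp, ← Algebra.smul_def,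
      smul_smul, inv_mul_cancel₀ hne, one_smul]
  rw [heq]
  exact Subalgebra.smul_mem _ h _

/-! ### Step 2: injective sums of column monomials are polynomials in the power sums -/

/-- The injective sum `IS(L) = ∑_{f : Fin r → Fin n injective} ∏_k U_{f k}^{L_k}` of column
monomials with exponents `L_0, …, L_{r-1}` (for `r = n`: the `S_n`-orbit sum of a monomial,
`orbitSum_monomial_eq_injSum`). [cite: Domokos2009, Prop. 2.1 (proof)] -/
def injSum (r : ℕ) (L : Fin r → (ι →₀ ℕ)) : MvPolynomial (ι × Fin n) k :=
  ∑ f : Fin r → Fin n,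
    if Function.Injective f then ∏ kk : Fin r, colMonomial ι n (f kk) (L kk) else 0

omit [Fintype ι] in
/-- Column monomials multiply by adding exponents. [folklore] -/
theorem colMonomial_add (j : Fin n) (β₁ β₂ : ι →₀ ℕ) :
    colMonomial (k := k) ι n j (β₁ + β₂) = colMonomial ι n j β₁ * colMonomial ι n j β₂ := by
  rw [colMonomial, colMonomial, colMonomial, monomial_mul, Finsupp.mapDomain_add, mul_one]

omit [Fintype ι] in
/-- **The recursion for injective sums**: `p_β · IS(L) = IS(β :: L) + ∑_{k₀} IS(L[k₀ ↦ L_{k₀} + β])`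
— in `p_β · IS(L) = ∑_j ∑_f U_j^β ∏_k U_{f k}^{L_k}` either `j` is a new vector (`j ∉ im f`: the
terms of `IS(β :: L)`) or `j = f k₀` (the exponent of the `k₀`-th factor grows by `β`).
[cite: Domokos2009, Prop. 2.1 (proof: products of the [w] span)] -/
theorem powerSum_mul_injSum (β : ι →₀ ℕ) {r : ℕ} (L : Fin r → (ι →₀ ℕ)) :
    powerSum ι n β * injSum ι n r L =
      injSum ι n (r + 1) (Fin.cons β L) +
        ∑ k₀ : Fin r, injSum (k := k) ι n r (Function.update L k₀ (L k₀ + β)) := by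
  classical
  -- the generic term and its two parts
  set A : Fin n → (Fin r → Fin n) → MvPolynomial (ι × Fin n) k := fun j f =>
    colMonomial ι n j β * ∏ kk : Fin r, colMonomial ι n (f kk) (L kk) with hA
  -- (1) expand the left-hand side
  have hL : powerSum ι n β * injSum ι n r L =
      ∑ f : Fin r → Fin n, if Function.Injective f then ∑ j : Fin n, A j f else 0 := by
    rw [injSum, Finset.mul_sum]
    refine Finset.sum_congr rfl fun f _ => ?_
    split_ifs
    · rw [powerSum, Finset.sum_mul]
    · rw [mul_zero]
  -- (2) the new-vector part is `IS(β :: L)`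
  have hnew : injSum ι n (r + 1) (Fin.cons β L) =
      ∑ f : Fin r → Fin n, if Function.Injective f then
        ∑ j : Fin n, (if j ∈ Set.range f then 0 else A j f) else 0 := by
    rw [injSum]
    rw [← Fintype.sum_equiv (Fin.consEquiv fun _ : Fin (r + 1) => Fin n)
      (fun p : Fin n × (Fin r → Fin n) => if Function.Injective (Fin.cons p.1 p.2 : Fin (r + 1) → Fin n)
        then ∏ kk : Fin (r + 1), colMonomial ι n ((Fin.cons p.1 p.2 : Fin (r + 1) → Fin n) kk)
          ((Fin.cons β L : Fin (r + 1) → ι →₀ ℕ) kk) else 0)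
      _ (fun p => rfl)]
    rw [Fintype.sum_prod_type, Finset.sum_comm]
    refine Finset.sum_congr rfl fun f _ => ?_
    by_cases hf : Function.Injective f
    · rw [if_pos hf]
      refine Finset.sum_congr rfl fun j _ => ?_
      by_cases hj : j ∈ Set.range f
      · rw [if_neg (fun h => (Fin.cons_injective_iff.mp h).1 hj), if_pos hj]
      · rw [if_pos (Fin.cons_injective_iff.mpr ⟨hj, hf⟩), if_neg hj, Fin.prod_univ_succ]
        simp only [Fin.cons_zero, Fin.cons_succ, hA]
    · rw [if_neg hf]
      refine Finset.sum_eq_zero fun j _ => ?_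
      rw [if_neg (fun h => hf (Fin.cons_injective_iff.mp h).2)]
  -- (3) the old-vector part
  have hold : ∀ f : Fin r → Fin n, Function.Injective f →
      ∑ j : Fin n, (if j ∈ Set.range f then A j f else 0) =
        ∑ k₀ : Fin r, ∏ kk : Fin r, colMonomial ι n (f kk) (Function.update L k₀ (L k₀ + β) kk) := by
    intro f hf
    rw [← Finset.sum_filter]
    have hfilter : Finset.univ.filter (fun j : Fin n => j ∈ Set.range f) = Finset.univ.image f := by
      ext j
      simp [Set.mem_range, Finset.mem_image, eq_comm]
    rw [hfilter, Finset.sum_image (fun a _ b _ h => hf h)]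
    refine Finset.sum_congr rfl fun k₀ _ => ?_
    have hupd : (fun kk : Fin r => colMonomial (k := k) ι n (f kk)
        (Function.update L k₀ (L k₀ + β) kk)) =
        Function.update (fun kk => colMonomial ι n (f kk) (L kk)) k₀
          (colMonomial ι n (f k₀) (L k₀ + β)) := by
      funext kk
      by_cases hk : kk = k₀
      · subst hk
        rw [Function.update_self, Function.update_self]
      · rw [Function.update_of_ne hk, Function.update_of_ne hk]
    rw [hupd, Finset.prod_update_of_mem (Finset.mem_univ k₀), hA]
    dsimp only
    rw [← Finset.mul_prod_erase Finset.univ _ (Finset.mem_univ k₀), colMonomial_add,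
      Finset.sdiff_singleton_eq_erase]
    ring
  -- (4) assemble
  have hupdate : ∑ k₀ : Fin r, injSum (k := k) ι n r (Function.update L k₀ (L k₀ + β)) =
      ∑ f : Fin r → Fin n, if Function.Injective f then
        ∑ k₀ : Fin r, ∏ kk : Fin r, colMonomial ι n (f kk) (Function.update L k₀ (L k₀ + β) kk)
        else 0 := by
    simp only [injSum]
    rw [Finset.sum_comm]
    refine Finset.sum_congr rfl fun f _ => ?_
    by_cases hf : Function.Injective f
    · simp only [if_pos hf]
    · simp only [if_neg hf, Finset.sum_const_zero]
  rw [hL, hnew, hupdate, ← Finset.sum_add_distrib]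
  refine Finset.sum_congr rfl fun f _ => ?_
  by_cases hf : Function.Injective f
  · rw [if_pos hf, if_pos hf, if_pos hf, ← hold f hf, ← Finset.sum_add_distrib]
    refine Finset.sum_congr rfl fun j _ => ?_
    by_cases hj : j ∈ Set.range f
    · rw [if_pos hj, if_pos hj, zero_add]
    · rw [if_neg hj, if_neg hj, add_zero]
  · rw [if_neg hf, if_neg hf, if_neg hf, add_zero]

omit [Fintype ι] in
/-- **Injective sums are polynomials in the power sums** (induction on the number of factors with
the recursion `powerSum_mul_injSum`). [cite: Domokos2009, Prop. 2.1] -/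
theorem injSum_mem_adjoin_powerSum (r : ℕ) (L : Fin r → (ι →₀ ℕ)) :
    injSum (k := k) ι n r L ∈ Algebra.adjoin k (Set.range (powerSum (k := k) ι n)) := by
  classical
  induction r with
  | zero =>
    have h : injSum (k := k) ι n 0 L = 1 := by
      rw [injSum, Fintype.sum_unique]
      rw [if_pos (Function.injective_of_subsingleton _), Finset.univ_eq_empty, Finset.prod_empty]
    rw [h]
    exact Subalgebra.one_mem _
  | succ r ih =>
    have hrec := powerSum_mul_injSum (k := k) ι n (L 0) (Fin.tail L)
    rw [Fin.cons_self_tail] at hrec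
    have h : injSum (k := k) ι n (r + 1) L = powerSum ι n (L 0) * injSum ι n r (Fin.tail L) -
        ∑ k₀ : Fin r, injSum ι n r (Function.update (Fin.tail L) k₀ (Fin.tail L k₀ + L 0)) := by
      rw [hrec, add_sub_cancel_right]
    rw [h]
    refine Subalgebra.sub_mem _ (Subalgebra.mul_mem _ (Algebra.subset_adjoin ⟨L 0, rfl⟩) (ih _))
      (Subalgebra.sum_mem _ fun k₀ _ => ih _)

/-! ### Step 1: orbit sums of monomials are injective sums; the theorem -/

/-- The column exponents of a monomial: `(cols s j) i = s (i, j)`. [folklore] -/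
def cols (s : ι × Fin n →₀ ℕ) (j : Fin n) : ι →₀ ℕ :=
  Finsupp.equivFunOnFinite.symm fun i => s (i, j)

/-- Unfolding of `cols`. [folklore] -/
@[simp]
theorem cols_apply (s : ι × Fin n →₀ ℕ) (j : Fin n) (i : ι) : cols ι n s j i = s (i, j) := by
  simp [cols]

/-- A monomial exponent is the sum of its columns placed in their columns. [folklore] -/
theorem sum_mapDomain_cols (s : ι × Fin n →₀ ℕ) :
    ∑ j : Fin n, (cols ι n s j).mapDomain (fun i => (i, j)) = s := by
  classical
  ext ⟨i, j⟩
  rw [Finsupp.finsetSum_apply]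
  rw [Finset.sum_eq_single j]
  · rw [Finsupp.mapDomain_apply (fun a b h => (Prod.ext_iff.mp h).1), cols_apply]
  · intro j' _ hj'
    exact Finsupp.mapDomain_notin_range _ _ (by
      rintro ⟨i', h⟩
      exact hj' (Prod.ext_iff.mp h).2)
  · intro h
    exact absurd (Finset.mem_univ j) h

/-- **A monomial is the product of its column monomials.** [folklore] -/
theorem monomial_eq_prod_colMonomial (s : ι × Fin n →₀ ℕ) :
    monomial s (1 : k) = ∏ j : Fin n, colMonomial ι n j (cols ι n s j) := by
  conv_lhs => rw [← sum_mapDomain_cols ι n s]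
  rw [monomial_sum_index, C_1, one_mul]
  rfl

omit [Fintype ι] in
/-- Permuting the vectors permutes the column monomials. [folklore] -/
theorem rename_prodMap_colMonomial (τ : Equiv.Perm (Fin n)) (j : Fin n) (β : ι →₀ ℕ) :
    rename (Prod.map id ⇑τ) (colMonomial (k := k) ι n j β) = colMonomial ι n (τ j) β := by
  rw [colMonomial, colMonomial, rename_monomial, ← Finsupp.mapDomain_comp]
  rfl

/-- A sum over permutations is the sum over all self-maps restricted to the injective ones.
[folklore] -/
theorem sum_perm_eq_sum_ite_injective {M : Type*} [AddCommMonoid M] (F : (Fin n → Fin n) → M) :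
    ∑ τ : Equiv.Perm (Fin n), F ⇑τ =
      ∑ f : Fin n → Fin n, if Function.Injective f then F f else 0 := by
  classical
  rw [← Finset.sum_filter]
  refine Finset.sum_bij (fun τ _ => (⇑τ : Fin n → Fin n)) (fun τ _ => ?_) (fun τ₁ _ τ₂ _ h => ?_)
    (fun f hf => ?_) (fun τ _ => rfl)
  · exact Finset.mem_filter.mpr ⟨Finset.mem_univ _, τ.injective⟩
  · exact Equiv.ext (congrFun h)
  · obtain ⟨-, hinj⟩ := Finset.mem_filter.mp hf
    exact ⟨Equiv.ofBijective f (Finite.injective_iff_bijective.mp hinj), Finset.mem_univ _, rfl⟩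

/-- **The `S_n`-orbit sum of a monomial is an injective sum.** [cite: Domokos2009, Prop. 2.1 (proof)] -/
theorem orbitSum_monomial_eq_injSum (s : ι × Fin n →₀ ℕ) :
    ∑ τ : Equiv.Perm (Fin n), rename (Prod.map id ⇑τ) (monomial s (1 : k)) =
      injSum ι n n (cols ι n s) := by
  rw [injSum, ← sum_perm_eq_sum_ite_injective n
    (fun f : Fin n → Fin n => ∏ kk : Fin n, colMonomial (k := k) ι n (f kk) (cols ι n s kk))]
  refine Finset.sum_congr rfl fun τ _ => ?_
  rw [monomial_eq_prod_colMonomial, map_prod]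
  simp_rw [rename_prodMap_colMonomial]

/-- **Weyl's theorem on multisymmetric polynomials.** Over a field of characteristic zero, every
polynomial in `n` vectors of `|ι|` coordinates which is invariant under permuting the vectors is a
polynomial (with coefficients in `k`) in the elementary multisymmetric polynomials
`e_α = coeff_{T^α} ∏_j (1 + ∑_i X_{(i,j)} T_i)`: `k[V^n]^{S_n} = k[e_α : α]`. Weyl, *The Classical
Groups*, Chap. II §3, Theorem (2.3.A); the hypothesis on the characteristic is essential
(counterexamples in characteristic `0 < p ≤ n`). Proof: `G = (n!)⁻¹ ∑_τ τ·G` is a `k`-combination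
of orbit sums of monomials, which are injective sums (`orbitSum_monomial_eq_injSum`), hence
polynomials in the power sums (`injSum_mem_adjoin_powerSum`), hence in the `e_α`
(`powerSum_mem_adjoin_elemMultisymm`). [cite: Weyl1939, Chap. II §3 (Theorem 2.3.A)] -/
theorem IsMultisymmetric.mem_adjoin_elemMultisymm [CharZero k] {G : MvPolynomial (ι × Fin n) k}
    (hG : IsMultisymmetric ι n G) : G ∈ elemSubalgebra (k := k) ι n := by
  classical
  -- orbit sums of monomials lie in `k[e_α]`
  have hpow : Algebra.adjoin k (Set.range (powerSum (k := k) ι n)) ≤ elemSubalgebra (k := k) ι n :=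
    Algebra.adjoin_le (by
      rintro _ ⟨β, rfl⟩
      exact powerSum_mem_adjoin_elemMultisymm ι n β)
  have horbit : ∀ s : ι × Fin n →₀ ℕ,
      ∑ τ : Equiv.Perm (Fin n), rename (Prod.map id ⇑τ) (monomial s (1 : k)) ∈
        elemSubalgebra (k := k) ι n := fun s => by
    rw [orbitSum_monomial_eq_injSum]
    exact hpow (injSum_mem_adjoin_powerSum ι n n _)
  -- `n! • G = ∑_τ τ·G = ∑_s coeff_s G • (orbit sum of X^s)`
  set N : k := (Fintype.card (Equiv.Perm (Fin n)) : k) with hN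
  have hN0 : N ≠ 0 := by
    rw [hN, Nat.cast_ne_zero]
    exact Fintype.card_ne_zero
  have hsum : N • G = ∑ s ∈ G.support, coeff s G •
      ∑ τ : Equiv.Perm (Fin n), rename (Prod.map id ⇑τ) (monomial s (1 : k)) := by
    have h1 : N • G = ∑ τ : Equiv.Perm (Fin n), rename (Prod.map id ⇑τ) G := by
      rw [Finset.sum_congr rfl fun τ _ => hG τ, Finset.sum_const, Finset.card_univ,
        Nat.cast_smul_eq_nsmul]
    rw [h1]
    conv_lhs =>
      arg 2
      ext τ
      rw [as_sum G, map_sum]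
    rw [Finset.sum_comm]
    refine Finset.sum_congr rfl fun s _ => ?_
    rw [Finset.smul_sum]
    refine Finset.sum_congr rfl fun τ _ => ?_
    rw [← map_smul, smul_monomial, smul_eq_mul, mul_one]
  have hG' : G = N⁻¹ • ∑ s ∈ G.support, coeff s G •
      ∑ τ : Equiv.Perm (Fin n), rename (Prod.map id ⇑τ) (monomial s (1 : k)) := by
    rw [← hsum, smul_smul, inv_mul_cancel₀ hN0, one_smul]
  rw [hG']
  exact Subalgebra.smul_mem _ (Subalgebra.sum_mem _ fun s _ =>
    Subalgebra.smul_mem _ (horbit s) _) _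

end Literature.RingTheory.Multisymmetric
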